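import Summits.HodgeConjecture.HodgeConjecture.Theorems.MarkmanPartnerTransportPicardThreeK3SquaresQuadraticLemmas
import Summits.HodgeConjecture.HodgeConjecture.Theorems.MarkmanPartnerTransportPicardThreeK3SquaresCycleInducedClosure

/-!
# Route MarkmanPartnerTransport · crux `PicardThreeK3Squares` (stmt-HodgeConjecture-19652) —
# every non-zero transcendental Hodge endomorphism is annihilated on `T(S)` by a rational polynomial with
# NON-ZERO CONSTANT TERM; hence cycle-induced transcendental endomorphisms are INVERTIBLE on `T(S)` by a polynomial
# in themselves (the algebraic elements of `E(S)` form a subfield)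

Step 1 of the programme «VARESCO-SELF WITHOUT DEFORMATION» (seat notes, 2026-08-28; prover hodge-nonav-19652-p1 gen 9):
Varesco's Thm. 5.3 for SELF-similitudes can be derived from the Kuga–Satake statement by the subfield trick
(`ψ = (φ₀ψ⁻¹)⁻¹ φ₀` with `φ₀`, `φ₀ψ⁻¹` cycle-induced), which needs: the cycle-induced elements of the FIELD
`E(S) = End_Hdg T(S)` (Zarhin) are closed under inverses. This file proves the inverse-closure in the crux's
vocabulary, marking-free in its conclusion:

* `exists_annihilating_polynomial` — for a projective K3 surface `S` (granted markings) and `f ∈ End H²(S(ℂ); ℂ)`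
  rational and type-preserving, NOT zero on `T(S)`: there is `P ∈ ℚ[X]` with `P(0) ≠ 0` and `P(f) = 0` on `T(S)`
  (`IsAnnihilatedOnTranscendentalBy S f P`). Marking picture: `f` reads as `r ≠ 0` in the field `E` (Zarhin);
  `P := minpoly_ℚ r` has non-zero constant term (`minpoly.coeff_zero_ne_zero`); `P(r) = 0` transported to `T(S)`.
* `exists_polynomial_inverse_on_transcendental` — consequently some rational polynomial `Q` has
  `Q(f) (f y) = y` for every transcendental `y`.
* `exists_cycleInduced_inverse_on_transcendental` — a cycle-induced `f ≠ 0` on `T(S)` has a CYCLE-INDUCED `g` with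
  `g (f y) = y = f (g y)` on `T(S)`; `isCycleInduced_of_cycleInduced_mul_eq_on_transcendental` — the subfield
  trick: `Φ ∘ ψ = φ₀` on `T(S)` with `Φ ≠ 0`, `φ₀` cycle-induced forces `ψ` cycle-induced.

No definition, no sorry, no named fact beyond the displayed `Huybrechts_K3_marking_exists`; nothing here proves HC.
References: Zarhin, J. reine angew. Math. 341 (1983) Thm. 1.5.1, 1.6; Huybrechts, *Lectures on K3 Surfaces* Ch. 3
Thm. 3.3.7; Varesco, Math. Z. 305 (2023) §4 (Lemma 4.4, Thm. 4.5), §5 Thm. 5.3. `--supports stmt-HodgeConjecture-19652`.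
-/

set_option linter.dupNamespace false

noncomputable section

namespace Summit.HodgeConjecture.HodgeConjecture.Theorems.MarkmanPartnerTransport.KugaSatakeSimilitude

open scoped Manifold TensorProduct
open Module CategoryTheory MonoidalCategory CartesianMonoidalCategory Polynomial
open Literature.AlgebraicGeometry Literature.AlgebraicGeometry.Motives Literature.AlgebraicGeometry.HodgeTheory
open Literature.AlgebraicGeometry.Motives.HodgeStructure
open Literature.AlgebraicGeometry.Surfaces
open Literature.AlgebraicTopology.SingularHomology
open Summit.HodgeConjecture.HodgeConjecture.Theorems
open Summit.HodgeConjecture.HodgeConjecture.Theorems.MarkmanPartnerTransport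
open Summit.HodgeConjecture.HodgeConjecture.Theorems.NikulinTwinTransport
open Summit.HodgeConjecture.HodgeConjecture.Theorems.AnchorExistenceCMFloor
open Summit.HodgeConjecture.HodgeConjecture.Theorems.MarkmanPartnerTransport.RealMultiplicationRanks
open Summit.HodgeConjecture.HodgeConjecture.Theorems.MarkmanPartnerTransport.OneCycle

section Abstract

universe u

variable {V : Type u} [AddCommGroup V] [Module ℚ V] [Module.Finite ℚ V] {H : HodgeStructure V 2}

/-- In the endomorphism FIELD `E = End_Hdg(V)` (Zarhin) a non-zero element `r` is annihilated by a rational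
polynomial with NON-ZERO constant term — its minimal polynomial (`E` is a finite-dimensional domain).
[cite: Zarhin1983HodgeGroupsK3, Thm. 1.6] [cite: Huybrechts2016K3, Cor. 3.3.6] -/
theorem exists_aeval_eq_zero_of_ne_zero (hF : IsField H.endAlg) {r : H.endAlg} (hr : r ≠ 0) :
    ∃ P : ℚ[X], P.coeff 0 ≠ 0 ∧ aeval r P = 0 := by
  haveI := isDomain_endAlg_of_isField hF
  haveI : Module.Finite ℚ H.endAlg := finiteDimensional_endAlg H
  exact ⟨minpoly ℚ r, minpoly.coeff_zero_ne_zero (.of_finite ℚ r) hr, minpoly.aeval ℚ r⟩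

end Abstract

variable {S : SchemeOver ℂ}

/-- `Transc[S, y]`: `y` is cup-orthogonal to `N¹(S)`. Local notation only. -/
local notation3 (prettyPrint := false) "Transc[" S ", " y "]" =>
  (∀ d ∈ algebraicClasses S 1, cupProduct (rfl : 2 * 1 + 2 * 1 = 2 * 2) y d = 0)

/-! ### The annihilating polynomial with non-zero constant term -/

/-- **Annihilating polynomial with non-zero constant term.** For a projective K3 surface `S` (granted
markings) and `f ∈ End H²(S(ℂ); ℂ)` preserving rational classes and Hodge types and NOT vanishing on `T(S)`, there is
`P ∈ ℚ[X]` with `P.coeff 0 ≠ 0` and `P(f) y = 0` for every transcendental `y` (`IsAnnihilatedOnTranscendentalBy`).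
Marking picture: `f|_T` is a non-zero element `r` of the field `E = End_Hdg(T)` (Zarhin), `P = minpoly_ℚ r`.
[cite: Zarhin1983HodgeGroupsK3, Thm. 1.5.1 and Thm. 1.6] [cite: Huybrechts2016K3, Ch. 3 Thm. 3.3.7 and Lemma 3.3.1] -/
theorem exists_annihilating_polynomial (hmark : Huybrechts_K3_marking_exists) (hS : IsK3Surface S)
    (f : complexBetti S (2 * 1) →ₗ[ℂ] complexBetti S (2 * 1))
    (hf_rat : ∀ y, IsRationalClass y → IsRationalClass (f y))
    (hf_typ : ∀ (i j : ℕ) y, IsOfHodgeType 2 S (2 * 1) i j y → IsOfHodgeType 2 S (2 * 1) i j (f y))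
    (hf0 : ∃ y : complexBetti S (2 * 1), Transc[S, y] ∧ f y ≠ 0) :
    ∃ P : ℚ[X], P.coeff 0 ≠ 0 ∧ IsAnnihilatedOnTranscendentalBy S f P := by
  classical
  have h4 : 2 * 1 + 2 * 1 = 2 * 2 := rfl
  -- ### the marking picture (as in `OneCycle.generatedBy_or_hasComplexMultiplication_of_eigenvalue`)
  have hHT : Huybrechts_K3_hodgeTypes_H2 := Huybrechts_K3_hodgeTypes_H2_holds
  obtain ⟨η, p₀, x, hp₀, ⟨hp₀int, hp₀gen, hηint, hηcup, hx20, hx20'⟩, hxx, hxpos, hu⟩ := hmark S hS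
  set N := algebraicClasses S 1 with hNdef
  set σ := η.symm x with hσdef
  have hησ : η σ = x := by rw [hσdef, LinearEquiv.apply_symm_apply]
  have hxne : σ ≠ 0 := by
    intro h0
    have hx : x = 0 := by rw [← hησ, h0, map_zero]
    subst hx
    simp [k3Form] at hxpos
  have hxne' : x ≠ 0 := fun h => hxne (by rw [hσdef, h, map_zero])
  obtain ⟨h₁, -, h₃⟩ := hHT S hS σ hx20 hxne
  have hσbar : conjClass (ComplexPoints S) (2 * 1) σ = η.symm (star x) := conjClass_marking_symm η hηint x
  have hsmul0 : ∀ {c : ℂ}, c • p₀ = 0 → c = 0 := fun h => by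
    rcases smul_eq_zero.1 h with h | h
    · exact h
    · exact absurd h hp₀
  have hL11 : ∀ c : complexBetti S (2 * 1), IsRationalClass c → IsOfHodgeType 2 S (2 * 1) 1 1 c → c ∈ N :=
    fun c hc h11 => lefschetzOneOne_rational_holds hS.1 c hc h11
  have hND : ∀ c ∈ N, IsRationalClass c →
      (∀ d ∈ N, cupProduct (rfl : 2 * 1 + 2 * 1 = 2 * 2) c d = 0) → c = 0 :=
    fun c hcN hc hperp => anchorExistence_cmFloor_divisorClass_eq_zero_of_hodgeIndex
      hodgeIndex_surface_holds lefschetzOneOne_rational_holds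
      Grothendieck1969_supportedClasses_le_hodgeConiveau_holds hS hcN hc hperp
  -- the eigenvalue of `f` on `σ`
  obtain ⟨ev, heσ⟩ : ∃ ev : ℂ, f σ = ev • σ := by
    obtain ⟨t, ht⟩ := hx20' (f σ) (hf_typ 2 0 σ hx20)
    exact ⟨t, ht⟩
  -- rational classes are `Λ_ℚ`
  have hrat : ∀ c, IsRationalClass c ↔ ∃ w : K3Index → ℚ, η c = fun i => (w i : ℂ) :=
    isRationalClass_iff_of_marking hS η hηint
  -- the rational points of `N`
  let NQ : Submodule ℚ (K3Index → ℚ) :=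
    { carrier := {u | η.symm (fun j => (u j : ℂ)) ∈ N}
      add_mem' := fun {u v} hu hv => by
        simp only [Set.mem_setOf_eq, ratCastΛ_add, map_add]
        exact N.add_mem hu hv
      zero_mem' := by
        simp only [Set.mem_setOf_eq, ratCastΛ_zero, map_zero]
        exact N.zero_mem
      smul_mem' := fun q u hu => by
        simp only [Set.mem_setOf_eq, ratCastΛ_smul, map_smul]
        exact N.smul_mem _ hu }
  have memNQ : ∀ u, u ∈ NQ ↔ η.symm (fun j => (u j : ℂ)) ∈ N := fun u => Iff.rfl
  -- `(1,1)`-classes through the marking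
  have h11_iff : ∀ v : K3Index → ℂ, IsOfHodgeType 2 S (2 * 1) 1 1 (η.symm v) ↔
      (k3Form v x = 0 ∧ k3Form v (star x) = 0) := by
    intro v
    rw [h₃ (η.symm v), hηcup, hηcup, LinearEquiv.apply_symm_apply, hησ, hσbar, LinearEquiv.apply_symm_apply]
    constructor
    · rintro ⟨ha, hb⟩
      exact ⟨hsmul0 ha, hsmul0 hb⟩
    · rintro ⟨ha, hb⟩
      rw [ha, hb, zero_smul]
      exact ⟨rfl, rfl⟩
  -- `N_ℚ = Λ_ℚ ∩ {x, x̄}^⊥`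
  have hN : ∀ u : K3Index → ℚ, u ∈ NQ ↔
      (k3Form (fun i => (u i : ℂ)) x = 0 ∧ k3Form (fun i => (u i : ℂ)) (star x) = 0) := by
    intro u
    rw [memNQ, ← h11_iff]
    constructor
    · intro hu
      exact isOfHodgeType_of_mem_algebraicClasses_of_isSmoothProjective hS.1 1 hu
    · intro hu
      exact hL11 _ ((hrat _).2 ⟨u, LinearEquiv.apply_symm_apply _ _⟩) hu
  -- `N` is spanned by its rational classes, so `N_ℚ^⊥ ⊗ ℂ ⊥ N`
  have hspan := span_isRationalClass_eq_top_of_isSmoothProjective_holds.supportedClasses_eq_span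
    hS.1 (2 * 1) 1
  have horth : ∀ u ∈ k3FormRat.orthogonal NQ, ∀ d ∈ N, k3Form (fun j => (u j : ℂ)) (η d) = 0 := by
    intro u hu d hd
    rw [LinearMap.BilinForm.mem_orthogonal_iff] at hu
    have hd' : d ∈ Submodule.span ℂ {c : complexBetti S (2 * 1) |
        IsRationalClass c ∧ c ∈ supportedClasses S (2 * 1) 1} := by
      rw [← hspan]; exact hd
    clear hd
    induction hd' using Submodule.span_induction with
    | mem d hd =>
      obtain ⟨w, hw⟩ := (hrat d).1 hd.1
      have hwN : w ∈ NQ := by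
        rw [memNQ, ← hw, LinearEquiv.symm_apply_apply]
        exact hd.2
      rw [hw, k3Form_ratCast, k3FormRat_isSymm.eq, hu w hwN, Rat.cast_zero]
    | zero => rw [map_zero, k3Form_zero_right]
    | add c c' _ _ hc hc' => rw [map_add, k3Form_add_right, hc, hc', add_zero]
    | smul t c _ hc => rw [map_smul, k3Form_smul_right, hc, mul_zero]
  -- `N_ℚ ∩ N_ℚ^⊥ = 0` (Hodge index)
  have hdisj : Disjoint NQ (k3FormRat.orthogonal NQ) := by
    rw [Submodule.disjoint_def]
    intro u huN huT
    have hc0 : η.symm (fun j => (u j : ℂ)) = 0 :=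
      hND _ ((memNQ u).1 huN) ((hrat _).2 ⟨u, LinearEquiv.apply_symm_apply _ _⟩) fun d hd => by
        rw [hηcup, LinearEquiv.apply_symm_apply, horth u huT d hd, zero_smul]
    apply ratCastΛ_injective
    rw [ratCastΛ_zero]
    exact η.symm.injective (hc0.trans (map_zero _).symm)
  have hc := isCompl_orthogonal hdisj
  -- the transcendental Hodge structure, irreducible of K3 type, polarized; its endomorphism field
  set H := hodgeT hN hdisj hxx hxpos with hH
  have hK3 : H.IsOfK3Type := isOfK3Type_hodgeT hN hdisj hxx hxpos
  have hirr : H.IsIrreducible := isIrreducible_hodgeT hN hdisj hxx hxpos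
  set ψ : H.Polarization := polT hN hdisj hxx hxpos hu with hψ
  obtain ⟨hFld, ε, hεinj, hε⟩ := Zarhin1983_endAlg_isField_holds H hirr hK3
  have hω : omega x hdisj ∈ H.piece 2 0 := (mem_piece_two_zero_ofPeriod _ _).2 ⟨1, one_smul _ _⟩
  -- reading a rational type-preserving endomorphism of `H²(S)` in `E = End_Hdg(T)`
  have read : ∀ (G : complexBetti S (2 * 1) →ₗ[ℂ] complexBetti S (2 * 1)),
      (∀ y, IsRationalClass y → IsRationalClass (G y)) →
      (∀ (i j : ℕ) y, IsOfHodgeType 2 S (2 * 1) i j y → IsOfHodgeType 2 S (2 * 1) i j (G y)) →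
      ∃ (φ : Module.End ℚ (K3Index → ℚ)) (hφT : ∀ t ∈ k3FormRat.orthogonal NQ,
          φ t ∈ k3FormRat.orthogonal NQ),
        cxEnd φ = η.toLinearMap ∘ₗ G ∘ₗ η.symm.toLinearMap ∧ φ.restrict hφT ∈ H.endAlg := by
    intro G hG_rat hG_typ
    obtain ⟨φ, hφM, hφx, hφ11⟩ := anchorExistence_cmFloor_exists_ratEnd hHT hS η p₀ hp₀ hηint hηcup x hx20
      hx20' hxne G hG_rat hG_typ
    have hφT : ∀ t ∈ k3FormRat.orthogonal NQ, φ t ∈ k3FormRat.orthogonal NQ :=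
      fun t ht => map_mem_T hN φ hφx ht
    exact ⟨φ, hφT, hφM, restrict_mem_endAlg hN hdisj hxx hxpos φ hφT hφx hφ11⟩
  obtain ⟨φf, hφfT, hφfM, hrf⟩ := read f hf_rat hf_typ
  have hφfMapp : ∀ v, cxEnd φf v = η (f (η.symm v)) := fun v => by rw [hφfM]; rfl
  set r : H.endAlg := ⟨φf.restrict hφfT, hrf⟩ with hrdef
  have hrval : ((r : H.endAlg) : Module.End ℚ ↥(k3FormRat.orthogonal NQ)) = φf.restrict hφfT := rfl
  -- transcendental classes lie in `T_ℂ = ι(ℂ ⊗ T_ℚ)`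
  have htr : ∀ y : complexBetti S (2 * 1), Transc[S, y] →
      iota _ (lam hc (η y)) = η y := by
    intro y hy
    have hzN : ∀ n ∈ NQ, k3Form (η y) (fun i => (n i : ℂ)) = 0 := by
      intro n hn
      have h := hy _ ((memNQ n).1 hn)
      rw [hηcup, LinearEquiv.apply_symm_apply] at h
      exact hsmul0 h
    exact iota_lam_of_proj_eq_zero hc (cxEnd_projection_eq_zero hdisj hzN)
  -- `f` on `T` through `r`: `η (f y) = ι (r_ℂ z)` for `ι z = η y`
  have hfT : ∀ y : complexBetti S (2 * 1), Transc[S, y] →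
      η (f y) = iota _ (((r : H.endAlg) : Module.End ℚ ↥(k3FormRat.orthogonal NQ)).baseChange ℂ
        (lam hc (η y))) := by
    intro y hy
    rw [hrval, iota_baseChange_restrict φf hφfT, htr y hy, hφfMapp, LinearEquiv.symm_apply_apply]
  -- ### `r ≠ 0` (else `f = 0` on `T`)
  have hr0 : r ≠ 0 := by
    intro h
    obtain ⟨y, hy, hne⟩ := hf0
    apply hne
    apply η.injective
    rw [hfT y hy, h, Subalgebra.coe_zero, LinearMap.baseChange_zero, LinearMap.zero_apply, map_zero, map_zero]
  -- ### the minimal polynomial of `r` in the field `E` (abstract lemma), read on `T_ℚ`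
  obtain ⟨P, hP0, hPr0⟩ := exists_aeval_eq_zero_of_ne_zero hFld hr0
  refine ⟨P, hP0, ?_⟩
  intro y hy
  have hPr : ∀ t : ↥(k3FormRat.orthogonal NQ),
      (∑ i ∈ Finset.range (P.natDegree + 1), P.coeff i • (φf ^ i) (t : K3Index → ℚ)) = 0 := by
    intro t
    have h2 := congrArg
      (fun e : H.endAlg => (((e : Module.End ℚ ↥(k3FormRat.orthogonal NQ)) t : ↥(k3FormRat.orthogonal NQ)) :
        K3Index → ℚ)) hPr0
    simp only [Subalgebra.coe_zero, LinearMap.zero_apply, Submodule.coe_zero] at h2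
    refine Eq.trans ?_ h2
    rw [Polynomial.aeval_eq_sum_range, AddSubmonoidClass.coe_finsetSum, LinearMap.sum_apply,
      AddSubmonoidClass.coe_finsetSum]
    refine Finset.sum_congr rfl fun i _ => ?_
    rw [Subalgebra.coe_smul, Subalgebra.coe_pow, LinearMap.smul_apply, Submodule.coe_smul, hrval,
      Module.End.pow_restrict i hφfT, LinearMap.coe_restrict_apply]
  have hcxpow : ∀ i : ℕ, cxEnd (φf ^ i) = cxEnd φf ^ i := fun i => map_pow cxEndHom φf i
  have hpowη : ∀ (i : ℕ) (y : complexBetti S (2 * 1)), (cxEnd φf ^ i) (η y) = η ((f ^ i) y) := by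
    intro i
    induction i with
    | zero => intro y; rw [pow_zero, pow_zero, Module.End.one_apply, Module.End.one_apply]
    | succ i ih =>
      intro y
      rw [pow_succ', pow_succ', Module.End.mul_apply, Module.End.mul_apply, ih, hφfMapp,
        LinearEquiv.symm_apply_apply]
  -- on `T_ℂ = ι(ℂ ⊗ T_ℚ)`: the polynomial in `cxEnd φf` vanishes
  have hcx : ∀ w : ℂ ⊗[ℚ] ↥(k3FormRat.orthogonal NQ),
      (∑ i ∈ Finset.range (P.natDegree + 1), ((P.coeff i : ℚ) : ℂ) • (cxEnd φf ^ i) (iota _ w)) = 0 := by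
    intro w
    induction w using TensorProduct.induction_on with
    | zero => simp only [map_zero, smul_zero, Finset.sum_const_zero]
    | tmul c t =>
      rw [iota_tmul]
      calc (∑ i ∈ Finset.range (P.natDegree + 1),
            ((P.coeff i : ℚ) : ℂ) • (cxEnd φf ^ i) (c • fun j => (((t : K3Index → ℚ) j : ℚ) : ℂ)))
          = c • fun j => (((∑ i ∈ Finset.range (P.natDegree + 1),
              P.coeff i • (φf ^ i) (t : K3Index → ℚ)) j : ℚ) : ℂ) := by
            rw [ratCastΛ_sum, Finset.smul_sum]
            refine Finset.sum_congr rfl fun i _ => ?_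
            rw [ratCastΛ_smul, ← cxEnd_ratCast, hcxpow, map_smul, smul_comm]
        _ = 0 := by rw [hPr t, ratCastΛ_zero, smul_zero]
    | add w₁ w₂ h₁ h₂ =>
      rw [map_add]
      have : (∑ i ∈ Finset.range (P.natDegree + 1),
            ((P.coeff i : ℚ) : ℂ) • (cxEnd φf ^ i) (iota _ w₁ + iota _ w₂)) =
          (∑ i ∈ Finset.range (P.natDegree + 1), ((P.coeff i : ℚ) : ℂ) • (cxEnd φf ^ i) (iota _ w₁)) +
            ∑ i ∈ Finset.range (P.natDegree + 1), ((P.coeff i : ℚ) : ℂ) • (cxEnd φf ^ i) (iota _ w₂) := by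
        rw [← Finset.sum_add_distrib]
        refine Finset.sum_congr rfl fun i _ => ?_
        rw [map_add, smul_add]
      rw [this, h₁, h₂, add_zero]
  -- conclude for `y`: `η y = ι z`
  have hz := htr y hy
  have key : η (Polynomial.aeval f (P.map (algebraMap ℚ ℂ)) y) = 0 := by
    have hdeg : (P.map (algebraMap ℚ ℂ)).natDegree < P.natDegree + 1 :=
      lt_of_le_of_lt Polynomial.natDegree_map_le (Nat.lt_succ_self _)
    rw [Polynomial.aeval_eq_sum_range' hdeg, LinearMap.sum_apply, map_sum]
    have h := hcx (lam hc (η y))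
    rw [hz] at h
    refine Eq.trans ?_ h
    refine Finset.sum_congr rfl fun i _ => ?_
    rw [Polynomial.coeff_map, LinearMap.smul_apply, map_smul, eq_ratCast, hpowη]
  exact η.injective (by rw [key, map_zero])

/-- **Polynomial inverse on `T(S)`**: with `P(0) ≠ 0` and `P(f) = 0` on `T(S)`, the rational polynomial
`Q := −P(0)⁻¹ · (P − P(0))/X` in `f` inverts `f` on `T(S)`: for every transcendental `y`, `Q(f) (f y) = y`.
Consequently (with `…KugaSatakeBiquadratic.isCycleInducedTranscendentalEndomorphism_add` and
`SquareOfGenerator.exists_algebraicClass_pow_of_corrFst`) the cycle-induced elements of `E(S)` are closed under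
inverses — the subfield property used by «VARESCO-SELF WITHOUT DEFORMATION». [cite: Zarhin1983HodgeGroupsK3, Thm. 1.5.1] -/
theorem exists_polynomial_inverse_on_transcendental (hmark : Huybrechts_K3_marking_exists) (hS : IsK3Surface S)
    (f : complexBetti S (2 * 1) →ₗ[ℂ] complexBetti S (2 * 1))
    (hf_rat : ∀ y, IsRationalClass y → IsRationalClass (f y))
    (hf_typ : ∀ (i j : ℕ) y, IsOfHodgeType 2 S (2 * 1) i j y → IsOfHodgeType 2 S (2 * 1) i j (f y))
    (hf0 : ∃ y : complexBetti S (2 * 1), Transc[S, y] ∧ f y ≠ 0) :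
    ∃ Q : ℚ[X], ∀ y : complexBetti S (2 * 1), Transc[S, y] →
      Polynomial.aeval f (Q.map (algebraMap ℚ ℂ)) (f y) = y := by
  obtain ⟨P, hP0, hP⟩ := exists_annihilating_polynomial hmark hS f hf_rat hf_typ hf0
  -- `P = P(0) + X · R` with `R := P.divX`; take `Q := -P(0)⁻¹ · R`
  refine ⟨-(Polynomial.C (P.coeff 0)⁻¹ * P.divX), fun y hy => ?_⟩
  have hPy := hP y hy
  have hsplit : P.map (algebraMap ℚ ℂ) =
      Polynomial.C ((P.coeff 0 : ℚ) : ℂ) + Polynomial.X * (P.divX).map (algebraMap ℚ ℂ) := by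
    conv_lhs => rw [← Polynomial.divX_mul_X_add P]
    rw [Polynomial.map_add, Polynomial.map_mul, Polynomial.map_X, Polynomial.map_C, eq_ratCast, mul_comm,
      add_comm]
  rw [hsplit, map_add, map_mul, Polynomial.aeval_C, Polynomial.aeval_X, LinearMap.add_apply,
    Module.algebraMap_end_apply, Module.End.mul_apply] at hPy
  -- hPy : P(0) • y + f (R(f) y) = 0
  have hR : f (Polynomial.aeval f ((P.divX).map (algebraMap ℚ ℂ)) y) = -(((P.coeff 0 : ℚ) : ℂ) • y) :=
    eq_neg_of_add_eq_zero_right hPy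
  have hcomm : Polynomial.aeval f ((P.divX).map (algebraMap ℚ ℂ)) (f y) =
      f (Polynomial.aeval f ((P.divX).map (algebraMap ℚ ℂ)) y) := by
    have h : Polynomial.aeval f ((P.divX).map (algebraMap ℚ ℂ) * X) =
        Polynomial.aeval f (X * (P.divX).map (algebraMap ℚ ℂ)) := by rw [Polynomial.X_mul]
    rw [map_mul, map_mul, Polynomial.aeval_X] at h
    have h' := LinearMap.congr_fun h y
    rwa [Module.End.mul_apply, Module.End.mul_apply] at h'
  rw [Polynomial.map_neg, Polynomial.map_mul, Polynomial.map_C, map_neg, map_mul, Polynomial.aeval_C, LinearMap.neg_apply,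
    Module.End.mul_apply, hcomm, hR, Module.algebraMap_end_apply, map_inv₀, eq_ratCast, smul_neg, neg_neg, smul_smul,
    inv_mul_cancel₀ (by exact_mod_cast hP0 : ((P.coeff 0 : ℚ) : ℂ) ≠ 0), one_smul]

/-! ### Inverse closure: cycle-induced endomorphisms are invertible on `T(S)` by cycle-induced ones -/

/-- **Cycle-induced transcendental endomorphisms have cycle-induced inverses on `T(S)`.** For a projective
K3 surface `S` (granted markings) and a cycle-induced `f` not vanishing on `T(S)`, the cycle-induced
endomorphism `g := (Q² · X)(f) = Q(f) ∘ Q(f) ∘ f` (`Q` from `exists_polynomial_inverse_on_transcendental`,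
no constant term, `isCycleInducedTranscendentalEndomorphism_aeval_mul_X`) satisfies `g (f y) = y = f (g y)` for
every transcendental `y` — the subfield property of the cycle-induced part of `E(S)` (Zarhin: `E(S)` is a
field). Unconditional beyond the displayed marking fact; credits nothing to HC.
[cite: Zarhin1983HodgeGroupsK3, Thm. 1.5.1 and Thm. 1.6] [cite: GeemenSchutt2023, §4.8] [cite: Fulton1998, §16.1 Prop. 16.1.1] -/
theorem exists_cycleInduced_inverse_on_transcendental (hmark : Huybrechts_K3_marking_exists)
    (hS : IsK3Surface S) (f : complexBetti S (2 * 1) →ₗ[ℂ] complexBetti S (2 * 1))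
    (hf : IsCycleInducedTranscendentalEndomorphism S hS.isSmoothProjective f)
    (hf0 : ∃ y : complexBetti S (2 * 1), Transc[S, y] ∧ f y ≠ 0) :
    ∃ g : complexBetti S (2 * 1) →ₗ[ℂ] complexBetti S (2 * 1),
      IsCycleInducedTranscendentalEndomorphism S hS.isSmoothProjective g ∧
      ∀ y : complexBetti S (2 * 1), Transc[S, y] → g (f y) = y ∧ f (g y) = y := by
  obtain ⟨Q, hQ⟩ := exists_polynomial_inverse_on_transcendental hmark hS f hf.1 hf.2.1 hf0
  have hperp : ∀ y : complexBetti S (2 * 1), Transc[S, f y] := hf.2.2.2.1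
  refine ⟨Polynomial.aeval f ((Q * Q * X).map (algebraMap ℚ ℂ)),
    isCycleInducedTranscendentalEndomorphism_aeval_mul_X hS hf (Q * Q), fun y hy => ?_⟩
  have e : Polynomial.aeval f ((Q * Q * X).map (algebraMap ℚ ℂ)) =
      Polynomial.aeval f (Q.map (algebraMap ℚ ℂ)) * Polynomial.aeval f (Q.map (algebraMap ℚ ℂ)) * f := by
    rw [Polynomial.map_mul, Polynomial.map_mul, Polynomial.map_X, map_mul, map_mul, Polynomial.aeval_X]
  -- `Q(f)` commutes with `f`
  have hc : Polynomial.aeval f (Q.map (algebraMap ℚ ℂ)) * f = f * Polynomial.aeval f (Q.map (algebraMap ℚ ℂ)) := by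
    have h : Polynomial.aeval f (Q.map (algebraMap ℚ ℂ) * X) =
        Polynomial.aeval f (X * Q.map (algebraMap ℚ ℂ)) := by rw [Polynomial.X_mul]
    rwa [map_mul, map_mul, Polynomial.aeval_X] at h
  have hcw : ∀ w : complexBetti S (2 * 1), f (Polynomial.aeval f (Q.map (algebraMap ℚ ℂ)) w) =
      Polynomial.aeval f (Q.map (algebraMap ℚ ℂ)) (f w) := fun w => by
    have h := LinearMap.congr_fun hc w
    rw [Module.End.mul_apply, Module.End.mul_apply] at h
    exact h.symm
  refine ⟨?_, ?_⟩
  · rw [e, Module.End.mul_apply, Module.End.mul_apply, hQ (f y) (hperp y), hQ y hy]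
  · rw [e, Module.End.mul_apply, Module.End.mul_apply, hcw, hQ y hy, hQ y hy]

/-- **Quotients: the subfield trick.** If `Φ` and `φ₀` are cycle-induced transcendental endomorphisms of the
projective K3 surface `S` (granted markings), `Φ ≠ 0` on `T(S)`, and `ψ ∈ End H²(S(ℂ); ℂ)` (rational,
type-preserving, killing `N¹(S)`, image cup-orthogonal to `N¹(S)`) satisfies `Φ ∘ ψ = φ₀` on `T(S)`, then `ψ`
is cycle-induced: `ψ = Φ⁻¹ φ₀ = g ∘ φ₀` on `T(S)` with `g` the cycle-induced inverse
(`exists_cycleInduced_inverse_on_transcendental`), and agreement on `T(S)` suffices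
(`isCycleInduced_of_eq_on_transcendental`). This is the algebra of the seat note «VARESCO-SELF WITHOUT
DEFORMATION»: with `Φ`, `φ₀` supplied by the Kuga–Satake statement for `S` it yields Varesco's Thm. 5.3 for
self-similitudes without his deformation Lemma 4.4. Credits nothing to HC.
[cite: Varesco2023, §4 Thm. 4.5 and §5 Thm. 5.3] [cite: Zarhin1983HodgeGroupsK3, Thm. 1.5.1] -/
theorem isCycleInduced_of_cycleInduced_mul_eq_on_transcendental (hmark : Huybrechts_K3_marking_exists)
    (hS : IsK3Surface S) (Φ φ₀ ψ : complexBetti S (2 * 1) →ₗ[ℂ] complexBetti S (2 * 1))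
    (hΦ : IsCycleInducedTranscendentalEndomorphism S hS.isSmoothProjective Φ)
    (hΦ0 : ∃ y : complexBetti S (2 * 1), Transc[S, y] ∧ Φ y ≠ 0)
    (hφ₀ : IsCycleInducedTranscendentalEndomorphism S hS.isSmoothProjective φ₀)
    (h1 : ∀ y, IsRationalClass y → IsRationalClass (ψ y))
    (h2 : ∀ (i j : ℕ) y, IsOfHodgeType 2 S (2 * 1) i j y → IsOfHodgeType 2 S (2 * 1) i j (ψ y))
    (h3 : ∀ d ∈ algebraicClasses S 1, ψ d = 0)
    (h4 : ∀ y : complexBetti S (2 * 1), Transc[S, ψ y])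
    (heq : ∀ y : complexBetti S (2 * 1), Transc[S, y] → Φ (ψ y) = φ₀ y) :
    IsCycleInducedTranscendentalEndomorphism S hS.isSmoothProjective ψ := by
  obtain ⟨g, hg, hginv⟩ := exists_cycleInduced_inverse_on_transcendental hmark hS Φ hΦ hΦ0
  refine isCycleInduced_of_eq_on_transcendental hS ψ (g * φ₀) h1 h2 h3 h4
    (isCycleInducedTranscendentalEndomorphism_mul hS hg hφ₀) fun y hy => ?_
  rw [Module.End.mul_apply, ← heq y hy, (hginv (ψ y) (h4 y)).1]

end Summit.HodgeConjecture.HodgeConjecture.Theorems.MarkmanPartnerTransport.KugaSatakeSimilitude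

end
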